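import Mathlib
import Literature.Probability.RandomPlanarGeometry.HexSAW
import Summits.CriticalPhenomena.SAWScalingLimit.Theorems.ObservableToSLE.Negative.Identification
import Summits.CriticalPhenomena.SAWScalingLimit.Theorems.SAWMassiveIsingTiltDefs

/-!
# The tilted interface laws of route `SAWMassiveIsingTilt` are honest probability measures

Route `SAWMassiveIsingTilt` of `CriticalPhenomena/SAWScalingLimit`; lead prover of the line
`registered` of the crux `CriticalCurveContinuity` (stmt-CriticalPhenomena-7686), cycle 1. Objects
(`Zloop`, `tilt`, `tiltLaw`) are those of `Theorems/SAWMassiveIsingTiltDefs.lean`.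

For a bounded domain `Ω` and a nonzero mesh `δ` the discrete domain `Ω_δ ⊆ δℍ` has finitely many
edges (`finite_edgeSet_hexDomainGraph`), so the family of even subgraphs summed over in the loop-gas
partition function `Zloop(Ω_δ, S; y)` is finite (`finite_setOf_evenSubgraph`) and the `finsum` is an
honest finite sum with `1 ≤ Zloop` for `y ≥ 0` (`one_le_zloop`: the empty subgraph contributes `1`).
Consequently, for `x > 0`, `y ≥ 0` and endpoints joined in `Ω_δ`, the tilted interface law
`tiltLaw Ω δ x y u v` is a probability measure (`isProbabilityMeasure_tiltLaw_of_reachable`), and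
along every hexagonal endpoint approximation of a Dobrushin domain the tilted laws are EVENTUALLY
probability measures as `δ → 0⁺` (`eventually_isProbabilityMeasure_tiltLaw`) — the non-vacuity of
`TiltSLE x y` / `SameLimit` at every parameter point with `x > 0`, `0 ≤ y` used by both stubs of
the line and by the sibling cruxes `MassiveWindowSLE` (stmt-7685) and `RestrictionFromMass`
(stmt-7687). Moreover `tiltLaw` is ALWAYS a finite measure (`isFiniteMeasure_tiltLaw`), and for
finitely many SAWs and nonnegative weights its expectations are the finite weighted averages
`∫ f d𝔓_{x,y} = (Σ_γ w(γ) f(γ)) / Σ_γ w(γ)`, `w(γ) = x^{ℓ(γ)} Zloop(Ω_δ∖γ; y)`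
(`integral_tiltLaw_eq_sum_div`; `tilt_singleton`, `tilt_univ_eq_sum`, `tiltLaw_singleton`) — the
entrance to every finite-`δ` computation with the tilted family (scores, derivatives in `y`).
Finiteness of the SAW set and of the mesh vertices is imported from
`Theorems/ObservableToSLE/Negative/Identification.lean` (`finite_hexDomainSAW`,
`finite_embMeshVertices_hex`).
-/

noncomputable section

open MeasureTheory Filter Topology Set
open scoped NNReal ENNReal BoundedContinuousFunction
open Literature.Probability Literature.Probability.LatticeModels
  Literature.Probability.RandomPlanarGeometry
open Summit.CriticalPhenomena.SAWScalingLimit.Theorems.ObservableToSLE.Negative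
  (finite_hexDomainSAW finite_embMeshVertices_hex)

namespace Summit.CriticalPhenomena.SAWScalingLimit.Theorems.SAWMassiveIsingTilt

/-- The edge set of `Ω_δ ⊆ δℍ` is finite for bounded `Ω` and `δ ≠ 0`. -/
theorem finite_edgeSet_hexDomainGraph {Ω : Set ℂ} (hΩ : Bornology.IsBounded Ω) {δ : ℝ} (hδ : δ ≠ 0) :
    (SAW.hexDomainGraph Ω δ).edgeSet.Finite := by
  have hV : (SAW.embMeshVertices hexCenter Ω δ).Finite := finite_embMeshVertices_hex hΩ hδ
  refine ((hV.prod hV).image fun p : HexVertex × HexVertex => s(p.1, p.2)).subset ?_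
  intro e he
  induction e using Sym2.ind with
  | h u v =>
    rw [SimpleGraph.mem_edgeSet] at he
    have h := (SAW.embDomainGraph_adj_iff hexGraph hexCenter).1 he
    exact ⟨(u, v), ⟨SAW.embMeshDomain_subset _ _ _ _ h.2.1, SAW.embMeshDomain_subset _ _ _ _ h.2.2⟩,
      rfl⟩

/-- The family of even subgraphs of `Ω_δ` inside `S` summed over in `Zloop` is finite. -/
theorem finite_setOf_evenSubgraph {Ω : Set ℂ} (hΩ : Bornology.IsBounded Ω) {δ : ℝ} (hδ : δ ≠ 0)
    (S : Set HexVertex) :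
    {E : Finset (Sym2 HexVertex) |
      (∀ e ∈ E, e ∈ (SAW.hexDomainGraph Ω δ).edgeSet ∧ ∀ v ∈ e, v ∈ S) ∧
        ∀ v : HexVertex, Even (E.filter (fun e => v ∈ e)).card}.Finite := by
  have hE := finite_edgeSet_hexDomainGraph hΩ hδ
  refine (hE.finite_subsets.preimage Finset.coe_injective.injOn).subset ?_
  intro E hE'
  simp only [Set.mem_preimage, Set.mem_setOf_eq, Set.subset_def, Finset.mem_coe]
  exact fun e he => (hE'.1 e he).1

/-- `1 ≤ Zloop(Ω_δ, S; y)` for `y ≥ 0` (the empty subgraph contributes `1`, all terms are `≥ 0`). -/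
theorem one_le_zloop {Ω : Set ℂ} (hΩ : Bornology.IsBounded Ω) {δ : ℝ} (hδ : δ ≠ 0) {y : ℝ}
    (hy : 0 ≤ y) (S : Set HexVertex) : 1 ≤ Zloop (SAW.hexDomainGraph Ω δ) S y := by
  unfold Zloop
  have hfin := finite_setOf_evenSubgraph hΩ hδ S
  rw [finsum_mem_eq_finite_toFinset_sum _ hfin]
  have h0 : (∅ : Finset (Sym2 HexVertex)) ∈ hfin.toFinset := by
    rw [Set.Finite.mem_toFinset]
    simp
  calc (1 : ℝ) = y ^ (∅ : Finset (Sym2 HexVertex)).card := by simp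
    _ ≤ ∑ E ∈ hfin.toFinset, y ^ E.card :=
        Finset.single_le_sum (fun E _ => pow_nonneg hy _) h0

/-- If `u` and `v` are joined in `Ω_δ` (bounded `Ω`, `δ ≠ 0`), the tilted interface law at `x > 0`,
`y ≥ 0` is a probability measure. -/
theorem isProbabilityMeasure_tiltLaw_of_reachable {Ω : Set ℂ} (hΩ : Bornology.IsBounded Ω)
    {δ : ℝ} (hδ : δ ≠ 0) {x y : ℝ} (hx : 0 < x) (hy : 0 ≤ y) {u v : HexVertex}
    (h : (SAW.hexDomainGraph Ω δ).Reachable u v) :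
    IsProbabilityMeasure (tiltLaw Ω δ x y u v) := by
  classical
  haveI := finite_hexDomainSAW hΩ hδ u v
  haveI := Fintype.ofFinite (SAW.HexDomainSAW Ω δ u v)
  obtain ⟨p⟩ := h
  let γ₀ : SAW.HexDomainSAW Ω δ u v := ⟨p.toPath.1, p.toPath.2⟩
  have htot : tilt Ω δ x y u v Set.univ =
      ∑ γ : SAW.HexDomainSAW Ω δ u v, ENNReal.ofReal
        (x ^ γ.vertexCount * Zloop (SAW.hexDomainGraph Ω δ) {v | v ∉ γ.walk.support} y) := by
    rw [tilt, Measure.sum_apply _ MeasurableSpace.measurableSet_top, tsum_fintype]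
    simp only [Measure.smul_apply, smul_eq_mul, Measure.dirac_apply_of_mem (Set.mem_univ _), mul_one]
  have h0 : tilt Ω δ x y u v Set.univ ≠ 0 := by
    rw [htot]
    intro hsum
    have hγ := (Finset.sum_eq_zero_iff.1 hsum) γ₀ (Finset.mem_univ _)
    rw [ENNReal.ofReal_eq_zero] at hγ
    have hpos : 0 < x ^ γ₀.vertexCount * Zloop (SAW.hexDomainGraph Ω δ) {v | v ∉ γ₀.walk.support} y :=
      mul_pos (pow_pos hx _) (lt_of_lt_of_le one_pos (one_le_zloop hΩ hδ hy _))
    linarith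
  have htop : tilt Ω δ x y u v Set.univ ≠ ∞ := by
    rw [htot]
    exact ENNReal.sum_ne_top.2 fun _ _ => ENNReal.ofReal_ne_top
  exact ⟨by rw [tiltLaw, Measure.smul_apply, smul_eq_mul, ENNReal.inv_mul_cancel h0 htop]⟩

/-- Under an endpoint approximation the tilted interface laws at `x > 0`, `y ≥ 0` are eventually
probability measures. -/
theorem eventually_isProbabilityMeasure_tiltLaw : ∀ {D : DobrushinDomain} {a b : ℝ → HexVertex},
    SAW.IsEmbEndpointApprox hexGraph hexCenter D a b → ∀ {x y : ℝ}, 0 < x → 0 ≤ y →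
      ∀ᶠ δ in 𝓝[>] (0 : ℝ), IsProbabilityMeasure (tiltLaw D.carrier δ x y (a δ) (b δ)) := by
  intro D a b hab x y hx hy
  filter_upwards [hab.reachable, self_mem_nhdsWithin] with δ hr hδ
  exact isProbabilityMeasure_tiltLaw_of_reachable D.isBounded (ne_of_gt hδ) hx hy hr

/-! ### Expectations under the tilted law are finite weighted averages -/

/-- Singletons of SAWs are measurable (discrete σ-algebra). -/
theorem measurableSingletonClass_hexDomainSAW {Ω : Set ℂ} {δ : ℝ} {a b : HexVertex} :
    MeasurableSingletonClass (SAW.HexDomainSAW Ω δ a b) :=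
  ⟨fun _ => MeasurableSpace.measurableSet_top⟩

/-- The tilted weight of a single SAW: `w(γ) = x ^ ℓ(γ) · Zloop(Ω_δ ∖ γ; y)`. -/
theorem tilt_singleton {Ω : Set ℂ} {δ : ℝ} (x y : ℝ) {a b : HexVertex} (γ : SAW.HexDomainSAW Ω δ a b) :
    tilt Ω δ x y a b {γ} = ENNReal.ofReal
      (x ^ γ.vertexCount * Zloop (SAW.hexDomainGraph Ω δ) {v | v ∉ γ.walk.support} y) := by
  rw [tilt, Measure.sum_apply _ MeasurableSpace.measurableSet_top, tsum_eq_single γ]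
  · simp
  · intro γ' hγ'
    simp [hγ']

/-- Total tilted mass over a finite SAW set. -/
theorem tilt_univ_eq_sum {Ω : Set ℂ} {δ : ℝ} (x y : ℝ) {a b : HexVertex}
    [Fintype (SAW.HexDomainSAW Ω δ a b)] :
    tilt Ω δ x y a b Set.univ = ∑ γ : SAW.HexDomainSAW Ω δ a b, ENNReal.ofReal
      (x ^ γ.vertexCount * Zloop (SAW.hexDomainGraph Ω δ) {v | v ∉ γ.walk.support} y) := by
  rw [tilt, Measure.sum_apply _ MeasurableSpace.measurableSet_top, tsum_fintype]
  simp only [Measure.smul_apply, smul_eq_mul, Measure.dirac_apply_of_mem (Set.mem_univ _), mul_one]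

/-- The tilted law is always a finite measure (total mass `a⁻¹ · a ≤ 1`). -/
theorem isFiniteMeasure_tiltLaw {Ω : Set ℂ} {δ : ℝ} (x y : ℝ) {a b : HexVertex} :
    IsFiniteMeasure (tiltLaw Ω δ x y a b) := by
  refine ⟨?_⟩
  rw [tiltLaw, Measure.smul_apply, smul_eq_mul]
  set A := tilt Ω δ x y a b Set.univ
  by_cases h0 : A = 0
  · simp [h0]
  by_cases ht : A = ∞
  · simp [ht]
  rw [ENNReal.inv_mul_cancel h0 ht]
  exact ENNReal.one_lt_top

/-- Mass of a single SAW under the tilted law. -/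
theorem tiltLaw_singleton {Ω : Set ℂ} {δ : ℝ} (x y : ℝ) {a b : HexVertex} (γ : SAW.HexDomainSAW Ω δ a b) :
    tiltLaw Ω δ x y a b {γ} = (tilt Ω δ x y a b Set.univ)⁻¹ * ENNReal.ofReal
      (x ^ γ.vertexCount * Zloop (SAW.hexDomainGraph Ω δ) {v | v ∉ γ.walk.support} y) := by
  rw [tiltLaw, Measure.smul_apply, smul_eq_mul, tilt_singleton]

/-- **Expectations under the tilted law are finite weighted averages**: for nonnegative weights
(`x ≥ 0` and `Zloop ≥ 0` on every complement, e.g. `y ≥ 0` in a bounded domain) and finitely many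
SAWs, `∫ f d𝔓_{x,y} = (Σ_γ w(γ) f(γ)) / Σ_γ w(γ)` with `w(γ) = x^{ℓ(γ)} Zloop(Ω_δ∖γ; y)` (both sides
are `0` when the total weight vanishes). -/
theorem integral_tiltLaw_eq_sum_div {Ω : Set ℂ} {δ : ℝ} {x y : ℝ} {a b : HexVertex}
    [Fintype (SAW.HexDomainSAW Ω δ a b)]
    (hw : ∀ γ : SAW.HexDomainSAW Ω δ a b,
      0 ≤ x ^ γ.vertexCount * Zloop (SAW.hexDomainGraph Ω δ) {v | v ∉ γ.walk.support} y)
    (f : SAW.HexDomainSAW Ω δ a b → ℝ) :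
    ∫ γ, f γ ∂(tiltLaw Ω δ x y a b) =
      (∑ γ : SAW.HexDomainSAW Ω δ a b,
          x ^ γ.vertexCount * Zloop (SAW.hexDomainGraph Ω δ) {v | v ∉ γ.walk.support} y * f γ) /
        ∑ γ : SAW.HexDomainSAW Ω δ a b,
          x ^ γ.vertexCount * Zloop (SAW.hexDomainGraph Ω δ) {v | v ∉ γ.walk.support} y := by
  set w : SAW.HexDomainSAW Ω δ a b → ℝ := fun γ =>
    x ^ γ.vertexCount * Zloop (SAW.hexDomainGraph Ω δ) {v | v ∉ γ.walk.support} y with hwdef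
  have hw' : ∀ γ, 0 ≤ w γ := hw
  have huniv : tilt Ω δ x y a b Set.univ = ENNReal.ofReal (∑ γ, w γ) := by
    rw [tilt_univ_eq_sum, ENNReal.ofReal_sum_of_nonneg fun γ _ => hw' γ]
  haveI : MeasurableSingletonClass (SAW.HexDomainSAW Ω δ a b) := measurableSingletonClass_hexDomainSAW
  haveI := isFiniteMeasure_tiltLaw (Ω := Ω) (δ := δ) x y (a := a) (b := b)
  rw [integral_fintype Integrable.of_finite]
  have hsingle : ∀ γ, (tiltLaw Ω δ x y a b).real {γ} = (∑ γ', w γ')⁻¹ * w γ := by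
    intro γ
    rw [measureReal_def, tiltLaw_singleton, huniv, ENNReal.toReal_mul, ENNReal.toReal_inv,
      ENNReal.toReal_ofReal (Finset.sum_nonneg fun γ' _ => hw' γ'), ENNReal.toReal_ofReal (hw' γ)]
  simp only [hsingle, smul_eq_mul]
  rw [div_eq_inv_mul, Finset.mul_sum]
  refine Finset.sum_congr rfl fun γ _ => ?_
  ring

end Summit.CriticalPhenomena.SAWScalingLimit.Theorems.SAWMassiveIsingTilt

end
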